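import Literature.NumberTheory.EllipticCurves.PAdicDistributionIntegral
import Literature.NumberTheory.EllipticCurves.PadicSeriesEvaluation
import HarnessLib

/-!
# The two-variable Amice transform of a bounded distribution on `ℤ_p × ℤ_p`

For a bounded `ℚ_p`-valued distribution `μ` on `ℤ_p × ℤ_p` (a `BoundedDistribution` on the
product tower `ℤ_p × ℤ_p = lim (ℤ/p^n)²`, `PAdicDistributionIntegral.lean`) we define its
**two-variable Amice transform**

  `𝓐_μ(X, Y) = ∫ (1 + X)^s (1 + Y)^t dμ(s, t) := Σ_{i,j} ( ∫ (s choose i) (t choose j) dμ(s, t) ) X^i Y^j`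

(`MvPowerSeries (Fin 2) ℚ_p`, `X = X₀`, `Y = X₁`), prove that it is integral (`IsPadicInt`) when
`‖μ‖ ≤ 1`, and prove the **evaluation formula** on the open unit polydisc:

  `𝓐_μ(u, v) = ∫ (1 + u)^s (1 + v)^t dμ(s, t)`      (`‖u‖, ‖v‖ < 1`),

where `s ↦ (1 + u)^s = Σ_j (s choose j) u^j` is the binomial (Mahler) kernel, a continuous function
on `ℤ_p` (Mathlib `mahlerSeries`); in particular, at `u = γ^a − 1`, `v = γ^b − 1` for a principal
unit `γ` the value is the limit of the Riemann sums `Σ_{(x,y) mod p^n} μ_n(x, y) γ^{a x} γ^{b y}`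
(`tendsto_sum_mul_pow_padicEval₂_transform`).  This is the two-variable form of the `p`-adic Mellin
transform of Mazur–Tate–Teitelbaum 1986, §I.11–§I.13 (one variable: tree
`PAdicMeasureTransform.lean`), the analytic half ("switching between measures and power series is
permissible", Delbourgo 2008, p. 99) of the two-variable `p`-adic `L`-function of a Hida family
(Greenberg–Stevens 1993, Thm. 5.15; Kitagawa 1994, Thm. 1.1; Delbourgo 2008, Thm. 4.11 and
Def. 4.12), which is the transform of Kitagawa's measure `μ_𝐟` on `ℤ_p^× × ℤ_p^×` read in
Teichmüller–`γ` class coordinates.  Brick B1b of the bottom-up plan recorded with the named fact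
`greenbergStevens_kitagawa_twoVariable_interpolation_allBranches`; everything here is proved, there
are no named facts.

## Main definitions and results

* `binomKernel u : C(ℤ_[p], ℤ_[p])`, `s ↦ (1 + u)^s` (`‖u‖ < 1`); `binomKernel_natCast`:
  `(1 + u)^n` at `n ∈ ℕ`; `norm_binomKernel_sub_sum_le`: the Mahler tail estimate `‖u‖^N`.
* `BoundedDistribution.transform μ` — the two-variable Amice transform; `coeff_transform`,
  `norm_coeff_transform_le`, `isPadicInt_transform`.
* `BoundedDistribution.padicEval₂_transform` — **the evaluation formula** `𝓐_μ(u, v) = ∫ (1+u)^s (1+v)^t dμ`.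
* `BoundedDistribution.tendsto_sum_mul_pow_padicEval₂_transform` — at `(γ^a − 1, γ^b − 1)` the value
  is `lim_n Σ_{(x,y)} μ_n(x,y) γ^{a·x.val} γ^{b·y.val}`.

## References

* B. Mazur, J. Tate, J. Teitelbaum, *On `p`-adic analogues of the conjectures of Birch and
  Swinnerton-Dyer*, Invent. Math. 84 (1986), §I.11–§I.13. [MazurTateTeitelbaum1986Invent]
* D. Delbourgo, *Elliptic Curves and Big Galois Representations*, LMS LNS 356 (2008), Thm. 4.11,
  Def. 4.12, p. 99. [Delbourgo2008]
* R. Greenberg, G. Stevens, Invent. Math. 111 (1993), Thm. 5.15. [GreenbergStevens1993]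
* K. Kitagawa, Contemp. Math. 165 (1994), Thm. 1.1. [Kitagawa1994]
-/

noncomputable section

open Filter Topology

namespace Literature.NumberTheory.EllipticCurves

variable {p : ℕ} [Fact p.Prime]

/-! ### The binomial kernel `s ↦ (1 + u)^s` on `ℤ_p` -/

section Kernel

/-- The **binomial kernel** `s ↦ (1 + u)^s := Σ_j (s choose j) u^j` on `ℤ_p`, for `u ∈ ℤ_p` (meant
for `‖u‖ < 1`): the Mahler series with coefficients `u^j` (Mathlib `mahlerSeries`; it is the
continuous additive character of `ℤ_p` with value `1 + u` at `1`, `PadicInt.addChar_of_value_at_one`).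
[folklore] -/
def binomKernel (u : ℤ_[p]) : C(ℤ_[p], ℤ_[p]) := PadicInt.mahlerSeries (fun j => u ^ j)

/-- `(1 + u)^s = Σ'_j (s choose j) u^j`. [folklore] -/
theorem binomKernel_apply {u : ℤ_[p]} (hu : ‖u‖ < 1) (s : ℤ_[p]) :
    binomKernel u s = ∑' j : ℕ, mahler j s * u ^ j := by
  rw [binomKernel, PadicInt.mahlerSeries_apply (padicInt_tendsto_pow_of_norm_lt_one hu)]
  simp_rw [smul_eq_mul]

/-- The defining series of the kernel is summable. [folklore] -/
theorem summable_mahler_mul_pow {u : ℤ_[p]} (hu : ‖u‖ < 1) (s : ℤ_[p]) :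
    Summable fun j : ℕ => mahler j s * u ^ j := by
  refine NonarchimedeanAddGroup.summable_of_tendsto_cofinite_zero ?_
  rw [Nat.cofinite_eq_atTop, tendsto_zero_iff_norm_tendsto_zero]
  have h0 : Tendsto (fun j : ℕ => ‖u‖ ^ j) atTop (𝓝 0) :=
    tendsto_pow_atTop_nhds_zero_of_lt_one (norm_nonneg u) hu
  refine squeeze_zero (fun _ => norm_nonneg _) (fun j => ?_) h0
  rw [norm_mul, norm_pow]
  exact mul_le_of_le_one_left (pow_nonneg (norm_nonneg u) j) (PadicInt.norm_le_one _)

/-- **At natural numbers the kernel is the binomial power**: `(1 + u)^n = Σ_{j ≤ n} (n choose j) u^j`.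
[folklore] -/
theorem binomKernel_natCast {u : ℤ_[p]} (hu : ‖u‖ < 1) (n : ℕ) :
    binomKernel u (n : ℤ_[p]) = (1 + u) ^ n := by
  rw [binomKernel, PadicInt.mahlerSeries_apply_nat (padicInt_tendsto_pow_of_norm_lt_one hu) le_rfl,
    show (1 + u) = u + 1 from add_comm 1 u, (Commute.one_right u).add_pow]
  refine Finset.sum_congr rfl fun i _ => ?_
  rw [one_pow, mul_one, nsmul_eq_mul, Nat.cast_comm]

/-- The kernel takes values of norm `≤ 1`. [folklore] -/
theorem norm_binomKernel_le_one (u s : ℤ_[p]) : ‖binomKernel u s‖ ≤ 1 := PadicInt.norm_le_one _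

/-- **Mahler tail estimate**: `‖(1 + u)^s − Σ_{j < N} (s choose j) u^j‖ ≤ ‖u‖^N`. [folklore] -/
theorem norm_binomKernel_sub_sum_le {u : ℤ_[p]} (hu : ‖u‖ < 1) (N : ℕ) (s : ℤ_[p]) :
    ‖binomKernel u s - ∑ j ∈ Finset.range N, mahler j s * u ^ j‖ ≤ ‖u‖ ^ N := by
  have hs := summable_mahler_mul_pow hu s
  rw [binomKernel_apply hu, ← hs.sum_add_tsum_nat_add N, add_sub_cancel_left]
  refine IsUltrametricDist.norm_tsum_le_of_forall_le_of_nonneg (pow_nonneg (norm_nonneg u) N)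
    fun j => ?_
  rw [norm_mul, norm_pow, pow_add]
  calc ‖mahler (j + N) s‖ * (‖u‖ ^ j * ‖u‖ ^ N) ≤ 1 * (1 * ‖u‖ ^ N) := by
        gcongr
        · exact PadicInt.norm_le_one _
        · exact pow_le_one₀ (norm_nonneg u) hu.le
    _ = ‖u‖ ^ N := by ring

end Kernel

/-! ### Summability of `padicEval₂` for integral series -/

section Eval

/-- **For an integral two-variable series, the family defining `padicEval₂` is summable** on the
open unit polydisc (via the integral model and Mathlib's `MvPowerSeries.hasSum_eval₂` into the
linearly topologized complete ring `ℤ_p`).  This is the tree's `hasSum_padicEval₂`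
(`PadicPointsFiltration.lean`), copied privately to keep this file's imports to the `p`-adic
analysis layer. [folklore] -/
private theorem hasSum_padicEval₂_aux {F : MvPowerSeries (Fin 2) ℚ_[p]} (hF : IsPadicInt F) {u v : ℚ_[p]}
    (hu : ‖u‖ < 1) (hv : ‖v‖ < 1) :
    HasSum (fun d : Fin 2 →₀ ℕ => MvPowerSeries.coeff d F * (u ^ d 0 * v ^ d 1)) (padicEval₂ F u v) := by
  obtain ⟨G, rfl⟩ := isPadicInt_iff_exists_map.mp hF
  obtain ⟨u', rfl, hu'⟩ := exists_coe_eq_of_norm_lt_one hu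
  obtain ⟨v', rfl, hv'⟩ := exists_coe_eq_of_norm_lt_one hv
  have h := MvPowerSeries.hasSum_eval₂ (φ := RingHom.id ℤ_[p]) continuous_id
    (padicInt_hasEval_pair hu' hv') G
  have h' := h.map PadicInt.Coe.ringHom.toAddMonoidHom continuous_subtype_val
  have hf : (fun d : Fin 2 →₀ ℕ => MvPowerSeries.coeff d (G.map PadicInt.Coe.ringHom) *
      ((u' : ℚ_[p]) ^ d 0 * (v' : ℚ_[p]) ^ d 1)) =
      (⇑PadicInt.Coe.ringHom.toAddMonoidHom ∘ fun d =>
        (RingHom.id ℤ_[p]) (MvPowerSeries.coeff d G) * d.prod fun s e => ![u', v'] s ^ e) := by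
    funext d; simp
  rw [hf, padicEval₂_eq_coe_eval₂ G hu' hv']
  exact h'

end Eval

/-! ### Finite linearity of the abstract integral (complements to `PAdicDistributionIntegral`) -/

namespace BoundedDistribution

section Linear

variable {X : Type*} [PseudoMetricSpace X] {T : ProfiniteTower X}
variable {𝕜 : Type*} [NormedField 𝕜] [IsUltrametricDist 𝕜] [CompleteSpace 𝕜]
variable (D : BoundedDistribution T 𝕜)

/-- A finite sum of uniformly continuous functions (with values in a normed field) is uniformly
continuous. [folklore] -/
theorem _root_.Literature.NumberTheory.EllipticCurves.uniformContinuous_finset_sum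
    {Y : Type*} [UniformSpace Y] {E : Type*} [NormedField E] {ι : Type*} (s : Finset ι)
    {f : ι → Y → E} (hf : ∀ i ∈ s, UniformContinuous (f i)) :
    UniformContinuous (fun x => ∑ i ∈ s, f i x) := by
  classical
  induction s using Finset.induction_on with
  | empty => simp only [Finset.sum_empty]; exact uniformContinuous_const
  | insert a s ha ih =>
    simp only [Finset.sum_insert ha]
    exact (hf a (Finset.mem_insert_self a s)).add (ih fun i hi => hf i (Finset.mem_insert_of_mem hi))

/-- **The integral of a finite sum** of uniformly continuous functions is the sum of the
integrals. [folklore] -/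
theorem integral_finset_sum {ι : Type*} (s : Finset ι) {f : ι → X → 𝕜}
    (hf : ∀ i ∈ s, UniformContinuous (f i)) :
    D.integral (fun x => ∑ i ∈ s, f i x) = ∑ i ∈ s, D.integral (f i) := by
  classical
  induction s using Finset.induction_on with
  | empty =>
    simp only [Finset.sum_empty]
    exact D.integral_zero_fun
  | insert a s ha ih =>
    have hs : ∀ i ∈ s, UniformContinuous (f i) := fun i hi => hf i (Finset.mem_insert_of_mem hi)
    have hac : UniformContinuous (f a) := hf a (Finset.mem_insert_self a s)
    simp only [Finset.sum_insert ha]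
    rw [D.integral_add hac (uniformContinuous_finset_sum s hs), ih hs]

/-- **Homogeneity on the right**: `∫ f · c = (∫ f) · c`. [folklore] -/
theorem integral_mul_const (c : 𝕜) {f : X → 𝕜} (hf : UniformContinuous f) :
    D.integral (fun x => f x * c) = D.integral f * c := by
  simp_rw [mul_comm _ c]
  exact D.integral_const_mul c hf

end Linear

end BoundedDistribution

/-! ### The two-variable Amice transform -/

section Transform

variable (p) in
/-- The product tower `ℤ_p × ℤ_p = lim (ℤ/p^n)²`. [folklore] -/
abbrev padicIntSq : ProfiniteTower (ℤ_[p] × ℤ_[p]) :=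
  (ProfiniteTower.padicInt p).prod (ProfiniteTower.padicInt p)

/-- The **Mahler monomial** `(s, t) ↦ (s choose i) (t choose j)` as a `ℚ_p`-valued function on
`ℤ_p × ℤ_p`. [folklore] -/
def mahlerMonomial (i j : ℕ) : ℤ_[p] × ℤ_[p] → ℚ_[p] :=
  fun z => ((mahler i z.1 * mahler j z.2 : ℤ_[p]) : ℚ_[p])

/-- Unfolding lemma for `mahlerMonomial`. [folklore] -/
theorem mahlerMonomial_apply (i j : ℕ) (z : ℤ_[p] × ℤ_[p]) :
    mahlerMonomial i j z = ((mahler i z.1 * mahler j z.2 : ℤ_[p]) : ℚ_[p]) := rfl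

/-- The Mahler monomials are continuous. [folklore] -/
theorem continuous_mahlerMonomial (i j : ℕ) : Continuous (mahlerMonomial (p := p) i j) :=
  continuous_subtype_val.comp
    (((mahler i).continuous.comp continuous_fst).mul ((mahler j).continuous.comp continuous_snd))

/-- The Mahler monomials are uniformly continuous (`ℤ_p × ℤ_p` is compact). [folklore] -/
theorem uniformContinuous_mahlerMonomial (i j : ℕ) : UniformContinuous (mahlerMonomial (p := p) i j) :=
  CompactSpace.uniformContinuous_of_continuous (continuous_mahlerMonomial i j)

/-- The Mahler monomials take values of norm `≤ 1`. [folklore] -/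
theorem norm_mahlerMonomial_le_one (i j : ℕ) (z : ℤ_[p] × ℤ_[p]) : ‖mahlerMonomial i j z‖ ≤ 1 := by
  rw [mahlerMonomial_apply, PadicInt.padic_norm_e_of_padicInt]
  exact PadicInt.norm_le_one _

namespace BoundedDistribution

variable (D : BoundedDistribution (padicIntSq p) ℚ_[p])

/-- The **two-variable Amice transform** of a bounded distribution `μ` on `ℤ_p × ℤ_p`:
`𝓐_μ(X, Y) = Σ_{i,j} (∫ (s choose i)(t choose j) dμ(s,t)) X^i Y^j = "∫ (1 + X)^s (1 + Y)^t dμ(s, t)"`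
(`X = X₀ ↔` first coordinate, `Y = X₁ ↔` second coordinate) — the two-variable form of the
`p`-adic Mellin/Amice transform (Mazur–Tate–Teitelbaum 1986, §I.11–I.13; Delbourgo 2008, p. 99).
[cite: MazurTateTeitelbaum1986Invent, §I.13] -/
def transform : MvPowerSeries (Fin 2) ℚ_[p] := fun d => D.integral (mahlerMonomial (d 0) (d 1))

/-- The coefficients of the transform are the integrals of the Mahler monomials. [folklore] -/
theorem coeff_transform (d : Fin 2 →₀ ℕ) :
    MvPowerSeries.coeff d D.transform = D.integral (mahlerMonomial (d 0) (d 1)) := rfl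

/-- The coefficients of the transform are bounded by `‖μ‖`. [folklore] -/
theorem norm_coeff_transform_le (d : Fin 2 →₀ ℕ) : ‖MvPowerSeries.coeff d D.transform‖ ≤ D.bound := by
  rw [coeff_transform]
  have h := D.norm_integral_le (f := mahlerMonomial (d 0) (d 1))
    (uniformContinuous_mahlerMonomial _ _) zero_le_one (norm_mahlerMonomial_le_one _ _)
  rwa [mul_one] at h

/-- **The transform of a distribution of norm `≤ 1` is an integral series.** [folklore] -/
theorem isPadicInt_transform (hD : D.bound ≤ 1) : IsPadicInt D.transform :=
  fun d => (D.norm_coeff_transform_le d).trans hD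

end BoundedDistribution

end Transform

/-! ### The evaluation formula -/

section Evaluation

/-- The **product kernel** `(s, t) ↦ (1 + u)^s (1 + v)^t` on `ℤ_p × ℤ_p`, `ℚ_p`-valued. [folklore] -/
def binomKernel₂ (u v : ℤ_[p]) : ℤ_[p] × ℤ_[p] → ℚ_[p] :=
  fun z => ((binomKernel u z.1 * binomKernel v z.2 : ℤ_[p]) : ℚ_[p])

/-- Unfolding lemma for `binomKernel₂`. [folklore] -/
theorem binomKernel₂_apply (u v : ℤ_[p]) (z : ℤ_[p] × ℤ_[p]) :
    binomKernel₂ u v z = ((binomKernel u z.1 * binomKernel v z.2 : ℤ_[p]) : ℚ_[p]) := rfl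

/-- The product kernel is continuous. [folklore] -/
theorem continuous_binomKernel₂ (u v : ℤ_[p]) : Continuous (binomKernel₂ u v) :=
  continuous_subtype_val.comp
    (((binomKernel u).continuous.comp continuous_fst).mul
      ((binomKernel v).continuous.comp continuous_snd))

/-- The product kernel is uniformly continuous. [folklore] -/
theorem uniformContinuous_binomKernel₂ (u v : ℤ_[p]) : UniformContinuous (binomKernel₂ u v) :=
  CompactSpace.uniformContinuous_of_continuous (continuous_binomKernel₂ u v)

/-- The **truncated product kernel** `(s, t) ↦ (Σ_{i<N} (s choose i) u^i)(Σ_{j<N} (t choose j) v^j)`.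
[folklore] -/
def binomKernel₂Trunc (u v : ℤ_[p]) (N : ℕ) : ℤ_[p] × ℤ_[p] → ℚ_[p] :=
  fun z => (((∑ i ∈ Finset.range N, mahler i z.1 * u ^ i) *
    (∑ j ∈ Finset.range N, mahler j z.2 * v ^ j) : ℤ_[p]) : ℚ_[p])

/-- The truncated kernel is the box partial sum of Mahler monomials:
`Σ_{i,j<N} (s choose i)(t choose j) u^i v^j`. [folklore] -/
theorem binomKernel₂Trunc_eq_sum (u v : ℤ_[p]) (N : ℕ) (z : ℤ_[p] × ℤ_[p]) :
    binomKernel₂Trunc u v N z =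
      ∑ ij ∈ Finset.range N ×ˢ Finset.range N,
        mahlerMonomial ij.1 ij.2 z * ((u : ℚ_[p]) ^ ij.1 * (v : ℚ_[p]) ^ ij.2) := by
  rw [Finset.sum_product, binomKernel₂Trunc, Finset.sum_mul_sum, PadicInt.coe_sum]
  refine Finset.sum_congr rfl fun i _ => ?_
  rw [PadicInt.coe_sum]
  refine Finset.sum_congr rfl fun j _ => ?_
  rw [mahlerMonomial_apply]
  push_cast
  ring

/-- The truncated kernel is uniformly continuous. [folklore] -/
theorem uniformContinuous_binomKernel₂Trunc (u v : ℤ_[p]) (N : ℕ) :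
    UniformContinuous (binomKernel₂Trunc u v N) := by
  have h : binomKernel₂Trunc u v N = fun z => ∑ ij ∈ Finset.range N ×ˢ Finset.range N,
      mahlerMonomial ij.1 ij.2 z * ((u : ℚ_[p]) ^ ij.1 * (v : ℚ_[p]) ^ ij.2) :=
    funext (binomKernel₂Trunc_eq_sum u v N)
  rw [h]
  refine uniformContinuous_finset_sum _ fun ij _ => ?_
  have hc := (uniformContinuous_const_smul (M := ℚ_[p]) ((u : ℚ_[p]) ^ ij.1 * (v : ℚ_[p]) ^ ij.2)).comp
    (uniformContinuous_mahlerMonomial (p := p) ij.1 ij.2)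
  simpa only [Function.comp_def, smul_eq_mul, mul_comm] using hc

/-- **Uniform approximation of the kernel by its truncations**:
`‖(1+u)^s (1+v)^t − trunc_N(s, t)‖ ≤ max(‖u‖, ‖v‖)^N`. [folklore] -/
theorem norm_binomKernel₂_sub_trunc_le {u v : ℤ_[p]} (hu : ‖u‖ < 1) (hv : ‖v‖ < 1) (N : ℕ)
    (z : ℤ_[p] × ℤ_[p]) :
    ‖binomKernel₂ u v z - binomKernel₂Trunc u v N z‖ ≤ (max ‖u‖ ‖v‖) ^ N := by
  set A := binomKernel u z.1 with hA
  set B := binomKernel v z.2 with hB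
  set AN := ∑ i ∈ Finset.range N, mahler i z.1 * u ^ i with hAN
  set BN := ∑ j ∈ Finset.range N, mahler j z.2 * v ^ j with hBN
  have hcast : binomKernel₂ u v z - binomKernel₂Trunc u v N z =
      (((A - AN) * B + AN * (B - BN) : ℤ_[p]) : ℚ_[p]) := by
    rw [binomKernel₂_apply, binomKernel₂Trunc]
    push_cast
    ring
  rw [hcast, PadicInt.padic_norm_e_of_padicInt]
  have hr0 : 0 ≤ max ‖u‖ ‖v‖ := le_max_of_le_left (norm_nonneg u)
  have h1 : ‖(A - AN) * B‖ ≤ (max ‖u‖ ‖v‖) ^ N := by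
    rw [norm_mul]
    calc ‖A - AN‖ * ‖B‖ ≤ ‖u‖ ^ N * 1 :=
          mul_le_mul (norm_binomKernel_sub_sum_le hu N z.1) (PadicInt.norm_le_one _) (norm_nonneg _)
            (pow_nonneg (norm_nonneg u) N)
      _ ≤ (max ‖u‖ ‖v‖) ^ N := by
          rw [mul_one]; exact pow_le_pow_left₀ (norm_nonneg u) (le_max_left _ _) N
  have h2 : ‖AN * (B - BN)‖ ≤ (max ‖u‖ ‖v‖) ^ N := by
    rw [norm_mul]
    calc ‖AN‖ * ‖B - BN‖ ≤ 1 * ‖v‖ ^ N :=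
          mul_le_mul (PadicInt.norm_le_one _) (norm_binomKernel_sub_sum_le hv N z.2) (norm_nonneg _)
            zero_le_one
      _ ≤ (max ‖u‖ ‖v‖) ^ N := by
          rw [one_mul]; exact pow_le_pow_left₀ (norm_nonneg v) (le_max_right _ _) N
  exact (IsUltrametricDist.norm_add_le_max _ _).trans (max_le h1 h2)

/-- The equivalence `ℕ × ℕ ≃ (Fin 2 →₀ ℕ)`, `(i, j) ↦ (X₀ ↦ i, X₁ ↦ j)`, indexing the monomials
`X^i Y^j`. [folklore] -/
def finTwoFinsuppEquiv : ℕ × ℕ ≃ (Fin 2 →₀ ℕ) :=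
  (finTwoArrowEquiv ℕ).symm.trans Finsupp.equivFunOnFinite.symm

/-- `finTwoFinsuppEquiv (i, j) 0 = i`. [folklore] -/
@[simp] theorem finTwoFinsuppEquiv_apply_zero (ij : ℕ × ℕ) : finTwoFinsuppEquiv ij 0 = ij.1 := by
  simp [finTwoFinsuppEquiv]

/-- `finTwoFinsuppEquiv (i, j) 1 = j`. [folklore] -/
@[simp] theorem finTwoFinsuppEquiv_apply_one (ij : ℕ × ℕ) : finTwoFinsuppEquiv ij 1 = ij.2 := by
  simp [finTwoFinsuppEquiv]

/-- The boxes `{0..N-1}²` exhaust `ℕ × ℕ`. [folklore] -/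
theorem tendsto_range_product_range_atTop :
    Tendsto (fun N : ℕ => Finset.range N ×ˢ Finset.range N) atTop atTop := by
  refine tendsto_atTop_finset_of_monotone (fun M N hMN => ?_) fun ij => ?_
  · exact Finset.product_subset_product (Finset.range_mono hMN) (Finset.range_mono hMN)
  · refine ⟨max ij.1 ij.2 + 1, ?_⟩
    simp only [Finset.mem_product, Finset.mem_range]
    omega

namespace BoundedDistribution

variable (D : BoundedDistribution (padicIntSq p) ℚ_[p])

/-- **The box partial sums of `𝓐_μ(u, v)` are the integrals of the truncated kernels**:
`Σ_{i,j<N} [X^iY^j]𝓐_μ · u^i v^j = ∫ trunc_N dμ`. [folklore] -/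
theorem sum_coeff_transform_mul_eq_integral_trunc (u v : ℤ_[p]) (N : ℕ) :
    ∑ ij ∈ Finset.range N ×ˢ Finset.range N,
        MvPowerSeries.coeff (finTwoFinsuppEquiv ij) D.transform * ((u : ℚ_[p]) ^ ij.1 * (v : ℚ_[p]) ^ ij.2) =
      D.integral (binomKernel₂Trunc u v N) := by
  have h : binomKernel₂Trunc u v N = fun z => ∑ ij ∈ Finset.range N ×ˢ Finset.range N,
      mahlerMonomial ij.1 ij.2 z * ((u : ℚ_[p]) ^ ij.1 * (v : ℚ_[p]) ^ ij.2) :=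
    funext (binomKernel₂Trunc_eq_sum u v N)
  rw [h, D.integral_finset_sum _ (fun ij _ => ?_)]
  · refine Finset.sum_congr rfl fun ij _ => ?_
    rw [coeff_transform, finTwoFinsuppEquiv_apply_zero, finTwoFinsuppEquiv_apply_one,
      D.integral_mul_const _ (uniformContinuous_mahlerMonomial _ _)]
  · have hc := (uniformContinuous_const_smul (M := ℚ_[p]) ((u : ℚ_[p]) ^ ij.1 * (v : ℚ_[p]) ^ ij.2)).comp
      (uniformContinuous_mahlerMonomial (p := p) ij.1 ij.2)
    simpa only [Function.comp_def, smul_eq_mul, mul_comm] using hc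

/-- **The evaluation formula for the two-variable Amice transform**: for `‖μ‖ ≤ 1` and `u, v` in the
open unit disc, `𝓐_μ(u, v) = ∫ (1 + u)^s (1 + v)^t dμ(s, t)` — the box partial sums of the
(summable) defining series are the integrals of the truncated kernels, which converge uniformly to
the kernel (Mazur–Tate–Teitelbaum 1986, §I.13, in two variables; Delbourgo 2008, p. 99).
[cite: MazurTateTeitelbaum1986Invent, §I.13] -/
theorem padicEval₂_transform (hD : D.bound ≤ 1) {u v : ℤ_[p]} (hu : ‖u‖ < 1) (hv : ‖v‖ < 1) :
    padicEval₂ D.transform u v = D.integral (binomKernel₂ u v) := by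
  -- the defining family is summable; transfer to `ℕ × ℕ` and read along the boxes
  have hu' : ‖(u : ℚ_[p])‖ < 1 := by rwa [PadicInt.padic_norm_e_of_padicInt]
  have hv' : ‖(v : ℚ_[p])‖ < 1 := by rwa [PadicInt.padic_norm_e_of_padicInt]
  have hs := hasSum_padicEval₂_aux (D.isPadicInt_transform hD) hu' hv'
  have hs' := (Equiv.hasSum_iff finTwoFinsuppEquiv).mpr hs
  have hbox : Tendsto (fun N : ℕ => ∑ ij ∈ Finset.range N ×ˢ Finset.range N,
      MvPowerSeries.coeff (finTwoFinsuppEquiv ij) D.transform *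
        ((u : ℚ_[p]) ^ ij.1 * (v : ℚ_[p]) ^ ij.2)) atTop (𝓝 (padicEval₂ D.transform u v)) := by
    have h := hs'.comp tendsto_range_product_range_atTop
    refine h.congr fun N => ?_
    simp only [Function.comp_def, finTwoFinsuppEquiv_apply_zero, finTwoFinsuppEquiv_apply_one]
  -- the box sums are the integrals of the truncated kernels
  have hbox' : Tendsto (fun N : ℕ => D.integral (binomKernel₂Trunc u v N)) atTop
      (𝓝 (padicEval₂ D.transform u v)) :=
    hbox.congr fun N => D.sum_coeff_transform_mul_eq_integral_trunc u v N
  -- which converge to the integral of the kernel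
  have hr1 : max ‖u‖ ‖v‖ < 1 := max_lt hu hv
  have hr0 : 0 ≤ max ‖u‖ ‖v‖ := le_max_of_le_left (norm_nonneg u)
  have hint : Tendsto (fun N : ℕ => D.integral (binomKernel₂Trunc u v N)) atTop
      (𝓝 (D.integral (binomKernel₂ u v))) :=
    D.tendsto_integral_of_forall_norm_sub_le (fun N => uniformContinuous_binomKernel₂Trunc u v N)
      (uniformContinuous_binomKernel₂ u v) (fun N => pow_nonneg hr0 N)
      (fun N z => by rw [norm_sub_rev]; exact norm_binomKernel₂_sub_trunc_le hu hv N z)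
      (tendsto_pow_atTop_nhds_zero_of_lt_one hr0 hr1)
  exact tendsto_nhds_unique hbox' hint

/-- For a principal unit `γ` (`‖γ − 1‖ < 1`) the points `γ^a − 1` lie in the open unit disc.
[folklore] -/
theorem norm_pow_sub_one_lt_one {γ : ℤ_[p]} (hγ : ‖γ - 1‖ < 1) (a : ℕ) : ‖γ ^ a - 1‖ < 1 := by
  obtain ⟨c, hc⟩ : (γ - 1) ∣ γ ^ a - 1 := by simpa using sub_dvd_pow_sub_pow γ 1 a
  rw [hc, norm_mul]
  calc ‖γ - 1‖ * ‖c‖ ≤ ‖γ - 1‖ * 1 := by gcongr; exact PadicInt.norm_le_one c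
    _ < 1 := by rw [mul_one]; exact hγ

/-- **The values of `𝓐_μ` at `(γ^a − 1, γ^b − 1)` are limits of the Riemann sums
`Σ_{(x,y) mod p^n} μ_n(x, y) γ^{a·x} γ^{b·y}`** (with the representatives `x.val, y.val ∈ ℕ`), for
`‖μ‖ ≤ 1` and a principal unit `γ`: the evaluation formula read on the Riemann sums of the
(uniformly continuous) kernel, using `(1 + (γ^a − 1))^m = γ^{am}` at natural numbers
(Mazur–Tate–Teitelbaum 1986, §I.13: `L(γ^j − 1) = ∫ ⟨x⟩^j dμ`, in two variables).
[cite: MazurTateTeitelbaum1986Invent, §I.13] -/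
theorem tendsto_sum_mul_pow_padicEval₂_transform (hD : D.bound ≤ 1) {γ : ℤ_[p]} (hγ : ‖γ - 1‖ < 1)
    (a b : ℕ) :
    Tendsto (fun n : ℕ => ∑ c : ZMod (p ^ n) × ZMod (p ^ n),
        D.μ n c * ((γ : ℚ_[p]) ^ (a * c.1.val) * (γ : ℚ_[p]) ^ (b * c.2.val)))
      atTop (𝓝 (padicEval₂ D.transform ((γ : ℚ_[p]) ^ a - 1) ((γ : ℚ_[p]) ^ b - 1))) := by
  have hu := norm_pow_sub_one_lt_one hγ a
  have hv := norm_pow_sub_one_lt_one hγ b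
  have heval := D.padicEval₂_transform hD hu hv
  push_cast at heval
  rw [heval]
  have h := D.tendsto_riemannSum_integral (uniformContinuous_binomKernel₂ (γ ^ a - 1) (γ ^ b - 1))
  refine h.congr fun n => ?_
  rw [riemannSum_def]
  refine Finset.sum_congr rfl fun c _ => ?_
  congr 1
  change binomKernel₂ (γ ^ a - 1) (γ ^ b - 1) (((c.1.val : ℕ) : ℤ_[p]), ((c.2.val : ℕ) : ℤ_[p])) = _
  rw [binomKernel₂_apply, binomKernel_natCast hu, binomKernel_natCast hv, add_sub_cancel,
    add_sub_cancel, ← pow_mul, ← pow_mul]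
  push_cast
  ring

end BoundedDistribution

end Evaluation

end Literature.NumberTheory.EllipticCurves

end
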